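import Summits.QuantumFields.BalabanUV.Beta.GAN24.KPerfTailAmplitude
import Summits.QuantumFields.BalabanUV.Beta.FP.TransportInfinityM

/-!
# `BalabanUV.Beta.FP.PerfectColumnUniform` — road «FP» for binder row D1, row **N7/IPROF-UNIF** (R-FP-15): THE COLUMN QUARTER OF THE PERFECT `m`-FOLD RESOLVENT
# IS `O(1∕Lc^m)` WITH AN `m`-UNIFORM RATE — `|colOf (KPerf Lc (sfStep Lc) (smStep 3 Lc) m) κ′ l x| ≤ c·((Lc:ℝ)^m)⁻¹·exp(−δ·|x|₁∕Lc^m)` for every `m ≥ 1`, with `c`, `δ`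
# INDEPENDENT OF `m` and DISPLAYED (the row's shape with the power `p = 1`; the power the consumer needs, `p = 5`, is NOT reached — located below)

NOT IN PRINT; OUR BOOKKEEPING over road P1's fibre estimates re-instantiated BY NAME (one leg quarter of gan24-p3's V19 «KPERF-TAIL» with its own constant).  HONEST FRAMING
(cell contract, verbatim): «discharging `BetaPertH` makes Bałaban's UV stability UNCONDITIONAL — a real constructive-QFT result; it is NOT the continuum limit and NOT the
Clay problem.»  HONEST DEPENDENCY (verbatim): «continuum YM on T⁴ ⇐ BetaPertH ∧ nine spine estimates (0/9 proved); BetaPertH ⇐ (D1) ∧ (D4) ∧ CAP+tail; G-an2-4 gates asym,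
D1 and NE2/3/4.»  THIS MODULE DISCHARGES NOTHING of N7 ∕ `hasym` ∕ (H3-b) ∕ H4-ASM ∕ row D1; cross-lane filing by an idle G-an2-4 swarm seat (unit
`b2b-balaban-gan24-formalise-leaf-04`, gen 37) on the owner's row IPROF-UNIF (`HOME/b2b-balaban-beta-d1-p3/LEAVES-FP.md`, N7-PROOF.v2 §7 (R4)).
NEVER «G-an2-4 closed»; NOT D1, NOT BetaPertH, NOT continuum, NOT Clay.

WHAT THE TREE ALREADY HAS (gan24-p3 gen 15, census `HOME/b2b-balaban-gan24-p3/WOODBURY-FIBRE.md` v9.1 row V19): ONE strip half-width for (I3′) at every relative blocking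
(`GAN24/KPerfTailRate.stripRegularKM_uniform`), the ratio-sharp (U2) (`StripLegVectorsRatio`, `StripLegUnitsJMRatio.cstSqR` — no `exp(κ·4·Lc^m)`), and
`GAN24/KPerfTailAmplitude.decays_KPerf_polyAmplitude`: `∀ m ≥ 1, Decays (KPerf … m) (C₀·((Lc:ℝ)^m)^6) (δ₀∕(Lc:ℝ)^m)` — ALL FOUR leg quarters at once, amplitude `n⁶` (from the
field–field quarter, `cstSqR ∋ R¹²`).  Read on the column (`TransportInfinityM.colOf K κ l x = K (−x) 0 (inl κ) (inr l)`) that is the row's shape with `p = −6`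
(observation of gan24-formalise-leaf-02-g33, journal 2026-08-20T17:19:37Z).

THE OBSERVATION OF THIS FILE.  In `StripLegUnitsJMRatio.norm_kFibW_jm_sq_le_cstSqR` the four leg cases close SEPARATELY and only their sum is `cstSqR`; the field–multiplier
case `(inl κ, inr l)` — the one `colOf` reads — closes at `A²·exp(4η)²·6⁵·5⁴·((Lc^m)²)⁻¹` (`StripLegUnitsJMRatio.fm_sq_le_ratio` + `StripLegUnitsJM.unit_fm_m`): no zero-alias
radius, NO positive power of the relative blocking.  Keeping that quarter alone through road P1's (U1) ∕ Paley–Wiener chain gives the column the amplitude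
`(5 + 2·aR 4)·e^{4κ}·5400·e^{2κ}·((Lc:ℝ)^m)⁻¹` with the SAME `m`-free `κ`.

THE LOCATED GAP (why `p = 1` is not what N7's (H3-b) needs; numbers, not adjectives).  The Kronecker coset mass of the column is `((Lc^m)^5)⁻¹`
(`TransportInfinityM.constReproSum_wStepM` ∕ `entryHyps_perfCol`), spread over `O((4∕κ)⁴)` effective cosets by the decay: the true sup is `≍ (Lc^m)⁻⁵` (`p = 5`), and the
first-order lattice-Taylor power counting of (H3-b) (`N⁸·Σ_u|w_L u|·Σ_x |x|·|w_R x|·sup_{‖z‖≥N‖v‖∕2}|∇K z| = N⁸·N⁻¹·N⁰·N⁻⁷‖v‖⁻⁷`) needs exactly the ℓ¹ masses of `p = 5`; with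
`p = 1` the same product is `N¹⁶·‖v‖⁻⁷`.  The fibre sup-bound route stops at `p = 1`: the missing four powers are the `((N∕M)²)^D·5^D` of
`StripLegVectorsRatio.reading_le_ratio` (the reading vector's ℓ²-over-aliases bounded by sup × alias count) and the Cauchy–Schwarz pairing — gan24-p3 V19 (a) «n-uniform
alias analysis in the scaled momentum, L–XL».  The structural alternative — a kernel-level COMPOSITION LAW of the minimiser columns + induction using the exact coset sums
and a one-step GRADIENT profile — is the shared composition lane's (H1)∕`D1Tel` transcription debt plus an estimate; neither is attempted here.  Records: journal lines of
this unit 2026-08-20T17:19Z ∕ 17:24Z, GAPS § G-gan24leaf04-g37-1, memo `HOME/b2b-balaban-gan24-formalise-leaf-04/g37/IPROF-UNIF-LOCATED.md`.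

CONTENT (`d = 3`; [our object] ∕ [folklore] ∕ [our proof]; 0 `def`, 0 cited fact, 0 sorry; every input a tree theorem BY NAME):
* §1 `norm_kFibW_jm_fm_sq_le` ∕ `legBound_jm_fm_of_inv_bound`: the field–multiplier quarter of road P1's (U2) at relative blocking `Lc^m` ALONE —
  `‖kFibW (Lc^(j+m)) (Lc^j) (sfStep Lc j) (smStep 3 Lc j) (inl κ) (repZ zx) (inr l) (repZ zy) p‖ ≤ A·exp(4η)·5400·((Lc:ℝ)^m)⁻¹` from an inverse bound `A` of the scaled arrow
  matrix (`StripLegUnitsJMRatio.fm_sq_le_ratio`, `FibreStripOfRows.apriori_sq_of_inv_bound`, rows `sigR_A` ∕ `rhoR_Q`).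
* §2 `stripRegular_fm_uniform` (every `Lc ≥ 1`): ONE `κ ∈ (0, 1∕4]` such that for ALL `m j x′ y′ κ′ l` the re-based (j, m)-fibre function of the field–multiplier quarter is
  `StripRegular … κ ((5 + 2·aR 4)·exp(κ·4)·5400·((Lc:ℝ)^m)⁻¹)` — `FibreStripJMHolds.stripRegularKM_of_rows`' route (radii from `exists_radii` on `m`-free data, (U1)
  `det_ne_zero_of_rows` ∕ `apriori_of_rows` at `N := Lc^(j+m)`) with the quantifier `∀ m` INSIDE and the (U2) bound of §1.
* §3 `abs_unitK_KTot_fm_le_uniform` (every `Lc ≥ 1`): the (j, m)-family columns,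
  `|unitK (sfStep Lc j) (smStep 3 Lc j) (KTot (Lc^(j+m)) (Lc^j)) x′ y′ (inl κ′) (inr l)| ≤ (5 + 2·aR 4)·e^{4κ}·5400·((Lc:ℝ)^m)⁻¹·e^{2κ}·exp(−(κ∕((3+1)·Lc^m))·|x′−y′|₁)`
  for ALL `m`, `j` — `FibreStripJM.uniformDecays_of_stripRegularKM`'s Paley–Wiener step for one quarter.
* §4 `abs_KPerf_fm_le_uniform` (`2 ≤ Lc`, `m ≥ 1`): the same for `KPerf Lc (sfStep Lc) (smStep 3 Lc) m` (`RealRateKMHolds.tendsto_KTot_KPerf_holds` + `le_of_tendsto'`).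
* §5 **`abs_colOf_KPerf_le_uniform`** (`2 ≤ Lc`): `∃ κ ∈ (0, 1∕4], ∀ m ≥ 1, ∀ κ′ l x, |colOf (KPerf … m) κ′ l x| ≤ ((5 + 2·aR 4)·e^{4κ}·5400·e^{2κ})·((Lc:ℝ)^m)⁻¹·exp(−(κ∕4)·(|x|₁∕Lc^m))`
  — the row's literal shape with `p = 1`, and **`abs_colOf_KPerf_le_uniform_numeric`**: `∃ δ > 0, ∀ m ≥ 1, …, ≤ (43200·(5 + 2·aR 4))·((Lc:ℝ)^m)⁻¹·exp(−δ·(|x|₁∕Lc^m))`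
  (`e^{6κ} ≤ e² ≤ 8`).

ABSOLUTE RULE (cell, verbatim): «No internally-minted statement may enter as a cited fact. Every hypothesis is either kernel-proved in this package or a
verbatim quotation of a PUBLISHED theorem with page reference.»  Nothing is cited; no `def`; no wall binder instantiated at a value.
-/

noncomputable section

open Matrix Complex Finset Filter Topology
open scoped Matrix.Norms.L2Operator Real BigOperators
open Literature.MathematicalPhysics.QuantumFieldTheory
open Literature.MathematicalPhysics.QuantumFieldTheory.Balaban1983to89
open Literature.MathematicalPhysics.QuantumFieldTheory.Balaban1983to89.Beta
open Literature.MathematicalPhysics.QuantumFieldTheory.LatticeForm (quo repZ)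
open Literature.Probability.LatticeModels (TorusSite Torus.proj)
open B12Sec2to5 (l1 l1_nonneg)
open B4Strip (Strip reVec ofRealVec)
open B4ContourShift (BZ StripRegular latticeKernel latticeKernel_decay supNorm)
open BlochFibreMatrix (stencil pieceMatrix)
open FibreInverseDecay (trigPolySymbol reVec_mem_BZ cphase)
open ExpKernelCalculus (MKer Decays)
open OneStepResolventKernel (Fib)
open OneStepKernelFamily (l1_neg_eq)
open Summit.QuantumFields.BalabanUV.Beta.HessKerDressedUnits (unitK)
open Summit.QuantumFields.BalabanUV.Beta.GAN24.CombesThomas (sfStep smStep)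
open Summit.QuantumFields.BalabanUV.Beta.GAN24.CombesThomasFibre (LegOn)
open Summit.QuantumFields.BalabanUV.Beta.GAN24.CombesThomasFibreStep (kFibW cphase_zero_left l1_sub_le_coarse)
open Summit.QuantumFields.BalabanUV.Beta.GAN24.ArrowOperator
open Summit.QuantumFields.BalabanUV.Beta.GAN24.ArrowScaling
open Summit.QuantumFields.BalabanUV.Beta.GAN24.ArrowAnchorZero (isUnit_innerArrow_zero)
open Summit.QuantumFields.BalabanUV.Beta.GAN24.ArrowAnchorReal (aR aR_pos arrowAnchorReal)
open Summit.QuantumFields.BalabanUV.Beta.GAN24.FibreDetStripOfAnchors (exists_radii)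
open Summit.QuantumFields.BalabanUV.Beta.GAN24.FibreDetStrip (apriori_of_rows det_ne_zero_of_rows abs_le_pi_of_mem_BZ)
open Summit.QuantumFields.BalabanUV.Beta.GAN24.StripLegUnits (lc_pos pow_pos')
open Summit.QuantumFields.BalabanUV.Beta.GAN24.StripLegUnitsJM (pow_le_pow_add quo_pow_add_smul_repZ unit_fm_m)
open Summit.QuantumFields.BalabanUV.Beta.GAN24.StripLegUnitsJMRatio (fm_sq_le_ratio exp_offset_repZ_le_ratio)
open Summit.QuantumFields.BalabanUV.Beta.GAN24.FibreStripOfRows (sigR rhoR sigR_pos sigR_A rhoR_Q apriori_sq_of_inv_bound radI_hyps radO_hyps)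
open Summit.QuantumFields.BalabanUV.Beta.GAN24.FibreStrip (omegaOut OmegaOut omegaOut_le OmegaOut_nonneg cOut4 cOut4_nonneg)
open Summit.QuantumFields.BalabanUV.Beta.GAN24.FibreStripJM (kFibΔM kFibΔM_repZ_eq_kFibW kFibΔM_eq_repZ stripRegular_kFibΔM unitK_KTot_eq_offset)
open Summit.QuantumFields.BalabanUV.Beta.GAN24.FibreStripJMHolds (one_le_pow_add)
open Summit.QuantumFields.BalabanUV.Beta.GAN24.RealRateKMHolds (tendsto_KTot_KPerf_holds)
open Summit.QuantumFields.BalabanUV.Beta.FP.PerfectObjects (KTot)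
open Summit.QuantumFields.BalabanUV.Beta.FP.PerfectObjectsT (KPerf)
open Summit.QuantumFields.BalabanUV.Beta.FP.TransportInfinityM (colOf colOf_apply)

namespace Summit.QuantumFields.BalabanUV.Beta.FP.PerfectColumnUniform

variable {Lc : ℕ} [NeZero Lc]

/-! ## §1 The field–multiplier quarter of (U2) at relative blocking `Lc^m`, alone -/

/-- [folklore] **(U2) FOR THE COLUMN QUARTER, SQUARED**: under the cut's slot ∕ row weights at blocking `N = Lc^(j+m)` (only the A-slot bound `σ ≤ 1` and the Q-row bound
`|ρ| ≤ N⁻⁵` are used) and the scaled a-priori bound with constant `A`, at box representatives `zx zy` of the relative blocking,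
`‖kFibW (Lc^(j+m)) (Lc^j) (sfStep Lc j) (smStep 3 Lc j) (inl κ) (repZ zx) (inr l) (repZ zy) p‖² ≤ A²·(exp(η·4)²·(6⁵·5⁴)·(((Lc:ℝ)^m)²)⁻¹)` — the «fm» case of
`StripLegUnitsJMRatio.norm_kFibW_jm_sq_le_cstSqR`, verbatim, stopped before the four-quarter sum. -/
theorem norm_kFibW_jm_fm_sq_le {η A : ℝ} (hη : 0 ≤ η) (hη4 : η ≤ 1 / 4) (m j : ℕ) {p : Fin 4 → ℂ}
    (him : ∀ i, |(p i).im| ≤ η) (hre : ∀ i, |(p i).re| ≤ π)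
    (σ ρ : AIdx 4 (TorusSite 4 (Lc ^ (j + m))) → ℝ) (hσ : ∀ i, 0 < σ i)
    (hσA : ∀ n κ, σ (Sum.inl (Sum.inl κ, n)) ≤ 1)
    (hρQ : ∀ κ, |ρ (Sum.inr (Sum.inl κ))| ≤ (((Lc : ℝ) ^ (j + m)) ^ 5)⁻¹)
    (hAP : ∀ x, ∑ i, (‖x i‖ / σ i) ^ 2 ≤ A ^ 2 * ∑ i, (ρ i * ‖(arrowMat (aliasArrow (Lc ^ (j + m)) p) *ᵥ x) i‖) ^ 2)
    (κ l : Fin (3 + 1)) (zx zy : TorusSite 4 (Lc ^ m)) :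
    ‖kFibW (Lc ^ (j + m)) (Lc ^ j) (sfStep Lc j) (smStep 3 Lc j) (Sum.inl κ) (repZ zx) (Sum.inr l) (repZ zy) p‖ ^ 2 ≤
      A ^ 2 * (Real.exp (η * 4) ^ 2 * ((6 : ℝ) ^ 5 * (5 : ℝ) ^ 4) * (((Lc : ℝ) ^ m) ^ 2)⁻¹) := by
  have hl : (0 : ℝ) < Lc := lc_pos
  have hl0 : (Lc : ℝ) ≠ 0 := hl.ne'
  have hM : 0 < Lc ^ j := pow_pos' j
  have hMN : Lc ^ j ≤ Lc ^ (j + m) := pow_le_pow_add j m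
  have hNR : ((Lc ^ (j + m) : ℕ) : ℝ) = (Lc : ℝ) ^ (j + m) := Nat.cast_pow Lc (j + m)
  have hratio : ((Lc ^ (j + m) : ℕ) : ℝ) / ((Lc ^ j : ℕ) : ℝ) = (Lc : ℝ) ^ m := by
    rw [Nat.cast_pow, Nat.cast_pow, pow_add, mul_div_cancel_left₀ _ (pow_ne_zero _ hl0)]
  have hratioInv : ((Lc ^ j : ℕ) : ℝ) / ((Lc ^ (j + m) : ℕ) : ℝ) = ((Lc : ℝ) ^ m)⁻¹ := by
    rw [Nat.cast_pow, Nat.cast_pow, pow_add, div_mul_eq_div_div, div_self (pow_ne_zero _ hl0), one_div]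
  have hsf : sfStep Lc j = (Lc : ℝ) ^ j := rfl
  have hsm : smStep 3 Lc j = (Lc : ℝ) ^ (j * 4) := rfl
  have hsm0 : 0 ≤ smStep 3 Lc j := by rw [hsm]; positivity
  have hφy : cphase (-quo (Lc ^ (j + m)) (((Lc ^ j : ℕ) : ℤ) • repZ zy)) p = 1 := by
    rw [quo_pow_add_smul_repZ, neg_zero, cphase_zero_left]
  have hex := exp_offset_repZ_le_ratio (Lc := Lc) hη m zx
  have h := fm_sq_le_ratio (N := Lc ^ (j + m)) (M := Lc ^ j) (sf := sfStep Lc j) (sm := smStep 3 Lc j) him hre hη hη4 hM hMN hσ hσA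
    (by positivity) hsm0 hAP κ (repZ zx) l (repZ zy) (hρQ l)
  rw [hratioInv, hratio, hsf, hsm, hφy, norm_one, mul_one] at h
  set ex : ℝ := Real.exp (η * ((Lc : ℝ) ^ m)⁻¹ * ∑ i, |((repZ zx i : ℤ) : ℝ)|) with hexd
  set E : ℝ := Real.exp (η * 4) with hE
  set l' : ℝ := (Lc : ℝ) with hldef
  calc _ ≤ _ := h
    _ = A ^ 2 * ((l' ^ j) ^ 2 * ((((l' ^ (j + m)) ^ 5)⁻¹ * l' ^ (j * 4)) ^ 2)) *
          (ex ^ 2 * ((6 : ℝ) ^ (3 + 1 + 1) * (((l' ^ m) ^ 2) ^ (3 + 1) * (5 : ℝ) ^ (3 + 1)))) := by ring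
    _ ≤ A ^ 2 * ((l' ^ m) ^ 10)⁻¹ * (E ^ 2 * ((6 : ℝ) ^ (3 + 1 + 1) * (((l' ^ m) ^ 2) ^ (3 + 1) * (5 : ℝ) ^ (3 + 1)))) := by
        rw [unit_fm_m hl0 j m]
        gcongr
    _ = A ^ 2 * (E ^ 2 * ((6 : ℝ) ^ 5 * (5 : ℝ) ^ 4) * ((l' ^ m) ^ 2)⁻¹) := by
        field_simp
        ring

/-- [folklore] `6⁵·5⁴ ≤ 5400²` (`5400 = 6³·25`), so `√(A²·(E²·6⁵·5⁴·R⁻²)) ≤ A·E·5400·R⁻¹` for `0 ≤ A`, `0 ≤ E`, `0 < R`. -/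
theorem sqrt_fm_const_le {A E R : ℝ} (hA : 0 ≤ A) (hE : 0 ≤ E) (hR : 0 < R) :
    Real.sqrt (A ^ 2 * (E ^ 2 * ((6 : ℝ) ^ 5 * (5 : ℝ) ^ 4) * (R ^ 2)⁻¹)) ≤ A * E * 5400 * R⁻¹ := by
  have hB : 0 ≤ A * E * 5400 * R⁻¹ := by positivity
  rw [← Real.sqrt_sq hB]
  refine Real.sqrt_le_sqrt ?_
  have hR2 : 0 < (R ^ 2)⁻¹ := by positivity
  have : A ^ 2 * (E ^ 2 * ((6 : ℝ) ^ 5 * (5 : ℝ) ^ 4) * (R ^ 2)⁻¹) ≤ A ^ 2 * (E ^ 2 * ((5400 : ℝ) ^ 2) * (R ^ 2)⁻¹) := by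
    gcongr
    norm_num
  refine this.trans (le_of_eq ?_)
  rw [← inv_pow]
  ring

/-- [folklore] **(U2) FOR THE COLUMN QUARTER AT ONE STRIP POINT, RELATIVE BLOCKING `Lc^m`**: on `|Im p_i| ≤ η ≤ 1∕4`, `|Re p_i| ≤ π`, an inverse bound `A ≥ 0` of the scaled arrow
matrix at `N = Lc^(j+m)` with radii `r` (`r_n > 0`, `r₀ > 0`) gives
`‖kFibW (Lc^(j+m)) (Lc^j) (sfStep Lc j) (smStep 3 Lc j) (inl κ) (repZ zx) (inr l) (repZ zy) p‖ ≤ A·exp(η·4)·5400·((Lc:ℝ)^m)⁻¹` — `FibreStripJMHolds.legBound_jm_of_inv_bound` for one quarter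
(the cut's weights `sigR`∕`rhoR` discharged by `sigR_A`, `rhoR_Q`, `apriori_sq_of_inv_bound`; the radius hypotheses `r_n² ≥ 4` and the zero-alias radius do not enter this quarter). -/
theorem legBound_jm_fm_of_inv_bound {η A r0 : ℝ} (hη : 0 ≤ η) (hη4 : η ≤ 1 / 4) (hA0 : 0 ≤ A) (m j : ℕ) {p : Fin 4 → ℂ}
    (him : ∀ i, |(p i).im| ≤ η) (hre : ∀ i, |(p i).re| ≤ π)
    (r : TorusSite 4 (Lc ^ (j + m)) → ℝ) (hr : ∀ n, 0 < r n) (hr0 : 0 < r0)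
    (hU : IsUnit (arrowMat (scaledArrow (Lc ^ (j + m)) r r0 p))) (hA : ‖(arrowMat (scaledArrow (Lc ^ (j + m)) r r0 p))⁻¹‖ ≤ A)
    (κ l : Fin (3 + 1)) (zx zy : TorusSite 4 (Lc ^ m)) :
    ‖kFibW (Lc ^ (j + m)) (Lc ^ j) (sfStep Lc j) (smStep 3 Lc j) (Sum.inl κ) (repZ zx) (Sum.inr l) (repZ zy) p‖ ≤
      A * Real.exp (η * 4) * 5400 * ((Lc : ℝ) ^ m)⁻¹ := by
  have hN : (((Lc ^ (j + m) : ℕ) : ℝ)) = (Lc : ℝ) ^ (j + m) := Nat.cast_pow Lc (j + m)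
  have hLm : (0 : ℝ) < (Lc : ℝ) ^ m := pow_pos lc_pos m
  have hsq := norm_kFibW_jm_fm_sq_le hη hη4 m j him hre (sigR (Lc ^ (j + m)) r r0) (rhoR (Lc ^ (j + m)) r r0) (sigR_pos hr hr0)
    (fun n κ => by rw [sigR_A]) (fun κ => by rw [rhoR_Q, hN, abs_of_nonneg (by positivity)]) (apriori_sq_of_inv_bound hr hr0 p hU hA) κ l zx zy
  have h1 : ‖kFibW (Lc ^ (j + m)) (Lc ^ j) (sfStep Lc j) (smStep 3 Lc j) (Sum.inl κ) (repZ zx) (Sum.inr l) (repZ zy) p‖ ≤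
      Real.sqrt (A ^ 2 * (Real.exp (η * 4) ^ 2 * ((6 : ℝ) ^ 5 * (5 : ℝ) ^ 4) * (((Lc : ℝ) ^ m) ^ 2)⁻¹)) := by
    rw [← Real.sqrt_sq (norm_nonneg _)]
    exact Real.sqrt_le_sqrt hsq
  exact h1.trans (sqrt_fm_const_le hA0 (Real.exp_pos _).le hLm)

/-! ## §2 ONE strip half-width for the column quarter at every relative blocking -/

/-- **ONE STRIP FOR THE COLUMN QUARTER AT ALL RELATIVE BLOCKINGS** [our object] (`d = 3`, every `Lc ≥ 1`): there is `κ ∈ (0, 1∕4]` such that for EVERY `m`, `j`, all base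
points `x′ y′` and components `κ′ l`, the re-based (j, m)-fibre function of the field–multiplier quarter is
`StripRegular (kFibΔM Lc (sfStep Lc) (smStep 3 Lc) m j (inl κ′) x′ (inr l) y′) κ ((5 + 2·aR 4)·exp(κ·4)·5400·((Lc:ℝ)^m)⁻¹)`.
Route of `FibreStripJMHolds.stripRegularKM_of_rows` ∕ `KPerfTailRate.stripRegularKM_uniform` with `∀ m` INSIDE the choice of radii (`exists_radii` on the `m`-free data `aR 4`,
`ArrowInnerShift.exists_cIn 3`, `cOut4`, `ρ₁ = 1∕2`, `η₁ = 1`, `omegaOut`∕`OmegaOut`; rows F3 `isUnit_innerArrow_zero`, F4, F5 `arrowAnchorReal`, F6 `ArrowOuterShift.outerLipschitz`;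
(U1) `det_ne_zero_of_rows` ∕ `apriori_of_rows` at `N := Lc^(j+m)`), and the one-quarter (U2) of §1 with both inverse bounds `2·(5∕2)`, `2·aR 4` weakened to `5 + 2·aR 4`. -/
theorem stripRegular_fm_uniform : ∃ κ : ℝ, 0 < κ ∧ κ ≤ 1 / 4 ∧
    ∀ (m j : ℕ) (x' y' : Fin (3 + 1) → ℤ) (κ' l : Fin (3 + 1)),
      StripRegular (kFibΔM Lc (sfStep Lc) (smStep 3 Lc) m j (Sum.inl κ') x' (Sum.inr l) y') κ
        ((5 + 2 * aR 4) * Real.exp (κ * 4) * 5400 * ((Lc : ℝ) ^ m)⁻¹) := by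
  obtain ⟨cIn, hcIn, hF4⟩ := GAN24.ArrowInnerShift.exists_cIn 3
  have haR : 0 ≤ aR 4 := le_of_lt (aR_pos 4)
  have haZ : (0 : ℝ) ≤ 5 / 2 := by norm_num
  have hρ₁ : (0 : ℝ) < 1 / 2 := by norm_num
  have hΩ : ∀ ρ, 0 < ρ → 0 ≤ OmegaOut ρ := OmegaOut_nonneg
  obtain ⟨ρ₀, κ₀, hρ₀, hρ, hsmallIn, hκ₀, hκ, hκη, hsmallOut⟩ := exists_radii OmegaOut haZ haR hcIn cOut4_nonneg hρ₁ one_pos hΩ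
  set κ : ℝ := min κ₀ (1 / 4) with hκdef
  have hκpos : 0 < κ := lt_min hκ₀ (by norm_num)
  have hκle : κ ≤ κ₀ := min_le_left _ _
  have hκ4 : κ ≤ 1 / 4 := min_le_right _ _
  have hmono : ∀ p : Fin (3 + 1) → ℂ, p ∈ Strip (3 + 1) κ → p ∈ Strip (3 + 1) κ₀ := fun p hp μ => ⟨(hp μ).1, (hp μ).2.trans hκle⟩
  have hA5 : 2 * (5 / 2 : ℝ) ≤ 5 + 2 * aR 4 := by linarith
  have hAR : 2 * aR 4 ≤ 5 + 2 * aR 4 := by linarith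
  have hA0 : (0 : ℝ) ≤ 5 + 2 * aR 4 := by linarith
  refine ⟨κ, hκpos, hκ4, fun m j x' y' κ' l => ?_⟩
  -- the four rows of road P1 at the fine blockings `N := Lc^(j+m)` (one-`N` generic, BY NAME)
  have hF3 : ∀ j : ℕ, IsUnit (arrowMat (innerArrow (Lc ^ (j + m)) (0 : Fin (3 + 1) → ℂ))) ∧
      ‖(arrowMat (innerArrow (Lc ^ (j + m)) (0 : Fin (3 + 1) → ℂ)))⁻¹‖ ≤ 5 / 2 := fun j => isUnit_innerArrow_zero
  have hF4m : ∀ (j : ℕ) (p : Fin (3 + 1) → ℂ) (r : ℝ), (∀ μ, ‖p μ‖ ≤ r) → r ≤ 1 / 2 →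
      ‖arrowMat (innerArrow (Lc ^ (j + m)) p) - arrowMat (innerArrow (Lc ^ (j + m)) 0)‖ ≤ cIn * r :=
    fun j p r hp hr => hF4 (Lc ^ (j + m)) p r hp hr
  have hF5m : ∀ (j : ℕ), ∀ q ∈ BZ (3 + 1), q ≠ 0 → IsUnit (arrowMat (outerArrow (Lc ^ (j + m)) q (ofRealVec q))) ∧
      ‖(arrowMat (outerArrow (Lc ^ (j + m)) q (ofRealVec q)))⁻¹‖ ≤ aR 4 :=
    fun j q hq hq0 => arrowAnchorReal (N := Lc ^ (j + m)) (one_le_pow_add j m) (abs_le_pi_of_mem_BZ hq) hq0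
  have hF6m : ∀ (j : ℕ), ∀ q ∈ BZ (3 + 1), q ≠ 0 → ∀ p : Fin (3 + 1) → ℂ, reVec p = q → ∀ η : ℝ, 0 ≤ η → η ≤ 1 → (∀ μ, |(p μ).im| ≤ η) →
      ‖arrowMat (outerArrow (Lc ^ (j + m)) q p) - arrowMat (outerArrow (Lc ^ (j + m)) q (ofRealVec q))‖ ≤ cOut4 * η * omegaOut q := by
    intro j q hq hq0 p hpq η hη0 hη1 him
    have h := GAN24.ArrowOuterShift.outerLipschitz (D := 4) (N := Lc ^ (j + m)) (one_le_pow_add j m) q hq hq0 p hpq η hη0 hη1 him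
    simpa only [cOut4, omegaOut, Nat.cast_ofNat] using h
  have hω : ∀ ρ₀ : ℝ, 0 < ρ₀ → ∀ q ∈ BZ (3 + 1), (∃ μ, ρ₀ / 2 ≤ |q μ|) → omegaOut q ≤ OmegaOut ρ₀ :=
    fun ρ₀ hρ₀ q _ hfar => omegaOut_le hρ₀ q hfar
  -- (U1) at the fine blocking `N = Lc^(j+m)`
  have hU1 : ∀ p ∈ Strip (3 + 1) κ₀, (trigPolySymbol (stencil (3 + 1)) (pieceMatrix (N := Lc ^ (j + m))) p).det ≠ 0 :=
    det_ne_zero_of_rows (N := Lc ^ (j + m)) omegaOut (hF3 j) (hF4m j) (hF5m j) (hF6m j) (hω ρ₀ hρ₀) haZ haR cOut4_nonneg hρ₀ hρ hsmallIn hκ₀.le hκ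
      hκη hsmallOut
  -- (U2) for the column quarter at `(N, M) = (Lc^(j+m), Lc^j)`, box representatives
  have hU2 : ∀ (zx zy : TorusSite (3 + 1) (Lc ^ m)), ∀ p ∈ Strip (3 + 1) κ,
      ‖kFibΔM Lc (sfStep Lc) (smStep 3 Lc) m j (Sum.inl κ') (repZ zx) (Sum.inr l) (repZ zy) p‖ ≤
        (5 + 2 * aR 4) * Real.exp (κ * 4) * 5400 * ((Lc : ℝ) ^ m)⁻¹ := by
    intro zx zy p hp
    have him : ∀ i, |(p i).im| ≤ κ := fun i => (hp i).2
    have hre : ∀ i, |(p i).re| ≤ π := fun i => (hp i).1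
    rw [kFibΔM_repZ_eq_kFibW]
    rcases apriori_of_rows (N := Lc ^ (j + m)) omegaOut (hF3 j) (hF4m j) (hF5m j) (hF6m j) (hω ρ₀ hρ₀) haZ haR cOut4_nonneg hρ₀ hρ hsmallIn hκ₀.le
        hκ hκη hsmallOut (hmono p hp) with ⟨-, hU, hA⟩ | ⟨-, hq0, hU, hA⟩
    · obtain ⟨hr, -, -⟩ := radI_hyps (N := Lc ^ (j + m))
      exact legBound_jm_fm_of_inv_bound hκpos.le hκ4 hA0 m j him hre (radI (Lc ^ (j + m))) hr one_pos hU (hA.trans hA5) κ' l zx zy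
    · have hq : reVec p ∈ BZ (3 + 1) := reVec_mem_BZ hp
      obtain ⟨hr, -⟩ := radO_hyps (N := Lc ^ (j + m)) hq hq0
      exact legBound_jm_fm_of_inv_bound hκpos.le hκ4 hA0 m j him hre (radO (Lc ^ (j + m)) (reVec p)) hr (hr 0) hU (hA.trans hAR) κ' l zx zy
  rw [kFibΔM_eq_repZ]
  exact stripRegular_kFibΔM hκpos.le _ _ m j (fun p hp => hU1 p (hmono p hp)) (Sum.inl κ') (repZ _) (Sum.inr l) (repZ _)
    (hU2 (Torus.proj (Lc ^ m) x') (Torus.proj (Lc ^ m) y'))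

/-! ## §3 The (j, m)-family columns: `j`- and `m`-uniform profile with ONE `κ` -/

/-- **THE COLUMNS OF THE UNIT-RESCALED (j, m)-RESOLVENTS ARE `O(1∕Lc^m)` WITH ONE RATE CONSTANT** [our object] (`d = 3`, every `Lc ≥ 1`): there is `κ ∈ (0, 1∕4]` with
`|unitK (sfStep Lc j) (smStep 3 Lc j) (KTot (Lc^(j+m)) (Lc^j)) x′ y′ (inl κ′) (inr l)| ≤ ((5 + 2·aR 4)·e^{4κ}·5400·((Lc:ℝ)^m)⁻¹)·e^{2κ}·exp(−(κ∕((3+1)·(Lc:ℝ)^m))·|x′ − y′|₁)`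
for ALL `m j x′ y′ κ′ l` — the Paley–Wiener step of `FibreStripJM.uniformDecays_of_stripRegularKM` (pv17's `latticeKernel_decay` on the `Lc^m`-block offset, sup → ℓ¹ rate,
`l1_sub_le_coarse`) run for the one quarter of §2. -/
theorem abs_unitK_KTot_fm_le_uniform : ∃ κ : ℝ, 0 < κ ∧ κ ≤ 1 / 4 ∧
    ∀ (m j : ℕ) (x' y' : Fin (3 + 1) → ℤ) (κ' l : Fin (3 + 1)),
      |unitK (sfStep Lc j) (smStep 3 Lc j) (KTot (d := 3) (Lc ^ (j + m)) (Lc ^ j)) x' y' (Sum.inl κ') (Sum.inr l)| ≤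
        ((5 + 2 * aR 4) * Real.exp (κ * 4) * 5400 * ((Lc : ℝ) ^ m)⁻¹) * Real.exp (2 * κ) *
          Real.exp (-(κ / ((3 + 1) * (Lc : ℝ) ^ m)) * l1 (x' - y')) := by
  obtain ⟨κ, hκ, hκ4, h⟩ := stripRegular_fm_uniform (Lc := Lc)
  refine ⟨κ, hκ, hκ4, fun m j x' y' κ' l => ?_⟩
  have haR : 0 ≤ aR 4 := le_of_lt (aR_pos 4)
  have hLm : (0 : ℝ) < (Lc : ℝ) ^ m := pow_pos lc_pos m
  have hS := h m j x' y' κ' l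
  have hCst0 : 0 ≤ (5 + 2 * aR 4) * Real.exp (κ * 4) * 5400 * ((Lc : ℝ) ^ m)⁻¹ := by positivity
  generalize hC : (5 + 2 * aR 4) * Real.exp (κ * 4) * 5400 * ((Lc : ℝ) ^ m)⁻¹ = Cst at hS hCst0 ⊢
  have hCst : 0 ≤ Cst := hCst0
  rw [unitK_KTot_eq_offset]
  split_ifs with hc
  · have h1 := latticeKernel_decay hS hκ.le (quo (Lc ^ m) x' - quo (Lc ^ m) y')
    have h2 := h1.trans (mul_le_mul_of_nonneg_left (FibreInverseDecay.exp_supNorm_le_exp_l1 hκ.le _) hCst)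
    have h3 := l1_sub_le_coarse (Lc := Lc ^ m) x' y'
    rw [Nat.cast_pow] at h3
    refine (Complex.abs_re_le_norm _).trans (h2.trans ?_)
    rw [mul_assoc]
    refine mul_le_mul_of_nonneg_left ?_ hCst
    rw [← Real.exp_add]
    refine Real.exp_le_exp.2 ?_
    have hd : (0 : ℝ) < (3 + 1 : ℝ) := by positivity
    have hkd : 0 ≤ κ / ((3 + 1 : ℝ) * (Lc : ℝ) ^ m) := div_nonneg hκ.le (by positivity)
    have key : κ / ((3 + 1) * (Lc : ℝ) ^ m) * l1 (x' - y') ≤ κ / (3 + 1) * l1 (quo (Lc ^ m) x' - quo (Lc ^ m) y') + 2 * κ := by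
      calc κ / ((3 + 1) * (Lc : ℝ) ^ m) * l1 (x' - y')
          ≤ κ / ((3 + 1) * (Lc : ℝ) ^ m) * ((Lc : ℝ) ^ m * l1 (quo (Lc ^ m) x' - quo (Lc ^ m) y') + 2 * ((Lc : ℝ) ^ m * (3 + 1))) :=
            mul_le_mul_of_nonneg_left (by exact_mod_cast h3) hkd
        _ = κ / (3 + 1) * l1 (quo (Lc ^ m) x' - quo (Lc ^ m) y') + 2 * κ := by field_simp
    show -(κ / ((3 : ℝ) + 1)) * l1 (quo (Lc ^ m) x' - quo (Lc ^ m) y') ≤ 2 * κ + -(κ / ((3 + 1) * (↑Lc) ^ m)) * l1 (x' - y')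
    linarith
  · rw [abs_zero]; positivity

/-! ## §4 The perfect `m`-fold resolvent's column quarter (`2 ≤ Lc`, `m ≥ 1`) -/

/-- **THE COLUMN QUARTER OF `KPerf … m` IS `O(1∕Lc^m)` WITH ONE RATE CONSTANT** [our object] (`d = 3`, `2 ≤ Lc`): with the `κ` of §2–§3, for every `m ≥ 1` and all `x′ y′ κ′ l`,
`|KPerf Lc (sfStep Lc) (smStep 3 Lc) m x′ y′ (inl κ′) (inr l)| ≤ ((5 + 2·aR 4)·e^{4κ}·5400·((Lc:ℝ)^m)⁻¹)·e^{2κ}·exp(−(κ∕((3+1)·Lc^m))·|x′ − y′|₁)` — the entrywise limit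
(`RealRateKMHolds.tendsto_KTot_KPerf_holds`) of the `j`-uniform bound of §3. -/
theorem abs_KPerf_fm_le_uniform (hLc : 2 ≤ Lc) : ∃ κ : ℝ, 0 < κ ∧ κ ≤ 1 / 4 ∧
    ∀ m, 1 ≤ m → ∀ (x' y' : Fin (3 + 1) → ℤ) (κ' l : Fin (3 + 1)),
      |KPerf (d := 3) Lc (sfStep Lc) (smStep 3 Lc) m x' y' (Sum.inl κ') (Sum.inr l)| ≤
        ((5 + 2 * aR 4) * Real.exp (κ * 4) * 5400 * ((Lc : ℝ) ^ m)⁻¹) * Real.exp (2 * κ) *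
          Real.exp (-(κ / ((3 + 1) * (Lc : ℝ) ^ m)) * l1 (x' - y')) := by
  obtain ⟨κ, hκ, hκ4, h⟩ := abs_unitK_KTot_fm_le_uniform (Lc := Lc)
  refine ⟨κ, hκ, hκ4, fun m hm x' y' κ' l => ?_⟩
  exact le_of_tendsto' ((tendsto_KTot_KPerf_holds hLc hm x' y' (Sum.inl κ') (Sum.inr l)).abs)
    fun j => h m j x' y' κ' l

/-! ## §5 The perfect minimiser column: the row's shape with `p = 1`, everything `m`-free and displayed -/

/-- **ROW IPROF-UNIF WITH THE POWER `p = 1`** [our object] (`d = 3`, `2 ≤ Lc`): there is `κ ∈ (0, 1∕4]` such that for every `m ≥ 1` and all `κ′ l x`,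
`|colOf (KPerf Lc (sfStep Lc) (smStep 3 Lc) m) κ′ l x| ≤ ((5 + 2·aR 4)·e^{4κ}·5400·e^{2κ}) · ((Lc:ℝ)^m)⁻¹ · exp(−(κ∕4)·(|x|₁ ∕ (Lc:ℝ)^m))` — amplitude `c·(Lc^m)^{−1}` and rate
`δ = κ∕4`, BOTH independent of `m` (`colOf_apply`, `|−x|₁ = |x|₁`).  The power the consumer (H3-b) needs is `p = 5`; see the header for why the fibre route stops at `1`. -/
theorem abs_colOf_KPerf_le_uniform (hLc : 2 ≤ Lc) : ∃ κ : ℝ, 0 < κ ∧ κ ≤ 1 / 4 ∧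
    ∀ m, 1 ≤ m → ∀ (κ' l : Fin 4) (x : Fin 4 → ℤ),
      |colOf (KPerf (d := 3) Lc (sfStep Lc) (smStep 3 Lc) m) κ' l x| ≤
        ((5 + 2 * aR 4) * Real.exp (κ * 4) * 5400 * Real.exp (2 * κ)) * ((Lc : ℝ) ^ m)⁻¹ *
          Real.exp (-(κ / 4) * (l1 x / (Lc : ℝ) ^ m)) := by
  obtain ⟨κ, hκ, hκ4, h⟩ := abs_KPerf_fm_le_uniform (Lc := Lc) hLc
  refine ⟨κ, hκ, hκ4, fun m hm κ' l x => ?_⟩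
  have hLm : (0 : ℝ) < (Lc : ℝ) ^ m := pow_pos lc_pos m
  have h1 := h m hm (-x) 0 κ' l
  rw [sub_zero, l1_neg_eq] at h1
  rw [colOf_apply]
  have hexp : -(κ / ((3 + 1) * (Lc : ℝ) ^ m)) * l1 x = -(κ / 4) * (l1 x / (Lc : ℝ) ^ m) := by
    field_simp
    ring
  have hamp : ((5 + 2 * aR 4) * Real.exp (κ * 4) * 5400 * ((Lc : ℝ) ^ m)⁻¹) * Real.exp (2 * κ) =
      ((5 + 2 * aR 4) * Real.exp (κ * 4) * 5400 * Real.exp (2 * κ)) * ((Lc : ℝ) ^ m)⁻¹ := by ring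
  rw [hexp, hamp] at h1
  exact h1

/-- [folklore] `e^{4κ}·e^{2κ} ≤ 8` for `κ ≤ 1∕4` (`e^{6κ} ≤ e² < 2.72² < 8`). -/
theorem exp_six_mul_le_eight {κ : ℝ} (hκ4 : κ ≤ 1 / 4) : Real.exp (κ * 4) * Real.exp (2 * κ) ≤ 8 := by
  rw [← Real.exp_add]
  have h1 : κ * 4 + 2 * κ ≤ 1 + 1 := by linarith
  refine (Real.exp_le_exp.2 h1).trans ?_
  rw [Real.exp_add]
  have he := Real.exp_one_lt_d9
  have he0 := Real.exp_pos (1 : ℝ)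
  nlinarith

/-- **ROW IPROF-UNIF WITH `p = 1` AND A NUMERIC AMPLITUDE** [our object] (`d = 3`, `2 ≤ Lc`): `∃ δ > 0, ∀ m ≥ 1, ∀ κ′ l x,
|colOf (KPerf Lc (sfStep Lc) (smStep 3 Lc) m) κ′ l x| ≤ (43200·(5 + 2·aR 4))·((Lc:ℝ)^m)⁻¹·exp(−δ·(|x|₁ ∕ (Lc:ℝ)^m))` (`43200 = 5400·8`; `aR 4` = road P1's real-anchor constant
`ArrowAnchorReal.aR 4`, an explicit closed-form real). -/
theorem abs_colOf_KPerf_le_uniform_numeric (hLc : 2 ≤ Lc) : ∃ δ : ℝ, 0 < δ ∧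
    ∀ m, 1 ≤ m → ∀ (κ' l : Fin 4) (x : Fin 4 → ℤ),
      |colOf (KPerf (d := 3) Lc (sfStep Lc) (smStep 3 Lc) m) κ' l x| ≤
        (43200 * (5 + 2 * aR 4)) * ((Lc : ℝ) ^ m)⁻¹ * Real.exp (-δ * (l1 x / (Lc : ℝ) ^ m)) := by
  obtain ⟨κ, hκ, hκ4, h⟩ := abs_colOf_KPerf_le_uniform (Lc := Lc) hLc
  refine ⟨κ / 4, by positivity, fun m hm κ' l x => (h m hm κ' l x).trans ?_⟩
  have haR : 0 ≤ aR 4 := le_of_lt (aR_pos 4)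
  have hLm : (0 : ℝ) < (Lc : ℝ) ^ m := pow_pos lc_pos m
  have h8 := exp_six_mul_le_eight hκ4
  have hrest : 0 ≤ ((Lc : ℝ) ^ m)⁻¹ * Real.exp (-(κ / 4) * (l1 x / (Lc : ℝ) ^ m)) := by positivity
  have hC : (5 + 2 * aR 4) * Real.exp (κ * 4) * 5400 * Real.exp (2 * κ) ≤ 43200 * (5 + 2 * aR 4) := by
    have : (5 + 2 * aR 4) * Real.exp (κ * 4) * 5400 * Real.exp (2 * κ) = (5 + 2 * aR 4) * 5400 * (Real.exp (κ * 4) * Real.exp (2 * κ)) := by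
      ring
    rw [this]
    nlinarith [h8, haR]
  calc (5 + 2 * aR 4) * Real.exp (κ * 4) * 5400 * Real.exp (2 * κ) * ((Lc : ℝ) ^ m)⁻¹ * Real.exp (-(κ / 4) * (l1 x / (Lc : ℝ) ^ m))
      = ((5 + 2 * aR 4) * Real.exp (κ * 4) * 5400 * Real.exp (2 * κ)) * (((Lc : ℝ) ^ m)⁻¹ * Real.exp (-(κ / 4) * (l1 x / (Lc : ℝ) ^ m))) := by
        ring
    _ ≤ (43200 * (5 + 2 * aR 4)) * (((Lc : ℝ) ^ m)⁻¹ * Real.exp (-(κ / 4) * (l1 x / (Lc : ℝ) ^ m))) :=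
        mul_le_mul_of_nonneg_right hC hrest
    _ = _ := by ring

end Summit.QuantumFields.BalabanUV.Beta.FP.PerfectColumnUniform

end
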